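import Literature.Analysis.FunctionSpaces.TorusMollifierEstimates
import Literature.Analysis.FunctionSpaces.TorusRademacher
import Mathlib.Analysis.Calculus.LineDeriv.IntegrationByParts
import HarnessLib

/-!
# Gradients of Lipschitz functions on the flat torus and of their mollifications

Analysis/FunctionSpaces support file (everything proved), building on `TorusRademacher`
(Rademacher on `T^d`, measurability of `∇ζ`, `‖∇ζ‖ ≤ L`). For an `L`-Lipschitz `ζ : T^d → ℝ`:

* `Torus.lipschitzWith_convolution_kernel`, `Torus.norm_gradient_convolution_kernel_le` —
  mollification by the standard kernel preserves the Lipschitz constant;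
* `Torus.norm_gradient_convolution_kernel_sub_le` — **at every point of differentiability,
  `∇(ζ ⋆ k_ε)(x) → ∇ζ(x)` as `ε → 0`**, quantitatively: for `η > 0` there is `ε₀ > 0` with
  `‖∇(ζ ⋆ k_ε)(x) - ∇ζ(x)‖ ≤ η` for `0 < ε ≤ ε₀`. Proof: `∂ⱼ(ζ ⋆ k_ε)(x) = ∫ ∂ⱼk_ε(z)
  (ζ(x - z) - ζ(x)) dz` (tree), first-order Taylor expansion of `ζ` at `x` on the support
  `‖reprc z‖ ≤ ε`, and the moment identity `∫ ∂ⱼk_ε(z) (reprc z)ᵢ dz = -δᵢⱼ` (integration by parts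
  on `ℝ^d` for the profile).

These are the facts about the Kantorovich potentials (`δ⁻¹`-Lipschitz) consumed by the Eulerian
form of Seis 2022, Lemma 3, where the potential is tested against mollified weak solutions.

## References

* C. Seis, Comm. Math. Phys. 399 (2023) (arXiv:2003.08794), §2.2, Lemma 3. [`Seis2022`]
* L. C. Evans, *Partial Differential Equations* (2010), §5.8.2–5.8.3 (Lipschitz functions and
  a.e. differentiability; mollification). [`Evans2010`]
-/

noncomputable section

open MeasureTheory Set Filter Metric Topology Function
open scoped ENNReal NNReal Convolution InnerProductSpace ContDiff

namespace Literature.Analysis.FunctionSpaces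

namespace Torus

variable {d : Type*} [Fintype d]

variable {L : ℝ≥0} {ζ : UnitAddTorus d → ℝ}

/-! ## Mollification of Lipschitz functions -/

variable [DecidableEq d] {ε : ℝ}

omit [DecidableEq d] in
/-- The mollification as a kernel average: `(ζ ⋆ k)(x) = ∫ k(z) ζ(x - z) dz`. [folklore] -/
theorem convolution_kernel_eq (ζ : UnitAddTorus d → ℝ) (ε : ℝ) (x : UnitAddTorus d) :
    (ζ ⋆ kernel ε) x = ∫ z, kernel ε z * ζ (x - z) := by
  rw [convolution_comm_real, convolution_lsmul]
  rfl

omit [DecidableEq d] in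
/-- **Mollification preserves the Lipschitz constant.** [folklore] -/
theorem lipschitzWith_convolution_kernel (hζ : LipschitzWith L ζ) (hε : 0 < ε)
    (hε' : ε ≤ 1 / 4) : LipschitzWith L (ζ ⋆ kernel ε) := by
  have hζc : Continuous ζ := hζ.continuous
  have hkc : Continuous (kernel (d := d) ε) := (isSmooth_kernel (d := d) hε hε').continuous
  have hint : ∀ x : UnitAddTorus d, Integrable (fun z => kernel ε z * ζ (x - z)) volume := fun x =>
    (hkc.mul (hζc.comp (continuous_const.sub continuous_id))).integrable_unitAddTorus
  refine LipschitzWith.of_dist_le_mul fun x x' => ?_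
  rw [convolution_kernel_eq, convolution_kernel_eq, dist_eq_norm, ← integral_sub (hint x) (hint x')]
  have hbound : ∀ z, ‖kernel ε z * ζ (x - z) - kernel ε z * ζ (x' - z)‖ ≤
      kernel ε z * (L * dist x x') := fun z => by
    rw [← mul_sub, norm_mul, Real.norm_eq_abs, abs_of_nonneg (kernel_nonneg hε.le z)]
    refine mul_le_mul_of_nonneg_left ?_ (kernel_nonneg hε.le z)
    rw [← dist_eq_norm]
    have := hζ.dist_le_mul (x - z) (x' - z)
    rwa [dist_sub_right] at this
  calc ‖∫ z, (kernel ε z * ζ (x - z) - kernel ε z * ζ (x' - z))‖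
      ≤ ∫ z, kernel ε z * (L * dist x x') :=
        norm_integral_le_of_norm_le ((hkc.integrable_unitAddTorus).mul_const _)
          (Eventually.of_forall hbound)
    _ = L * dist x x' := by rw [integral_mul_const, integral_kernel hε hε', one_mul]

omit [DecidableEq d] in
/-- `‖∇(ζ ⋆ k_ε)(x)‖ ≤ L` for an `L`-Lipschitz `ζ`. [folklore] -/
theorem norm_gradient_convolution_kernel_le (hζ : LipschitzWith L ζ) (hε : 0 < ε)
    (hε' : ε ≤ 1 / 4) (x : UnitAddTorus d) : ‖Torus.gradient (ζ ⋆ kernel ε) x‖ ≤ L :=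
  norm_gradient_le_of_lipschitz (lipschitzWith_convolution_kernel hζ hε hε') x

/-! ## The moment identity `∫ ∂ⱼk_ε(z) (reprc z)ᵢ dz = -δᵢⱼ` -/

omit [DecidableEq d] in
/-- The partial derivatives of the torus kernel are those of the profile at the centred
representative. [folklore] -/
theorem partialDeriv_kernel_eq [DecidableEq d] (hε : 0 < ε) (hε' : ε ≤ 1 / 4) (j : d) (z : UnitAddTorus d) :
    partialDeriv j (kernel ε) z =
      _root_.fderiv ℝ (profile (d := d) ε) (reprc z) (EuclideanSpace.single j 1) := by
  have hk1 : IsContDiff 1 (kernel (d := d) ε) := (isSmooth_kernel hε hε').isContDiff (by simp)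
  rw [partialDeriv_eq_fderiv_apply hk1, kernel, fderiv_transplant (support_profile_subset_quarter hε hε')]

omit [DecidableEq d] in
/-- Where `∂ⱼk_ε(z) ≠ 0` the centred representative is `ε`-small. [folklore] -/
theorem norm_reprc_le_of_partialDeriv_kernel_ne_zero [DecidableEq d] (hε : 0 < ε) (hε' : ε ≤ 1 / 4)
    {j : d} {z : UnitAddTorus d} (hz : partialDeriv j (kernel ε) z ≠ 0) : ‖reprc z‖ ≤ ε := by
  by_contra h
  rw [partialDeriv_kernel_eq hε hε', fderiv_profile_eq_zero hε (lt_of_not_ge h)] at hz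
  exact hz rfl

omit [Fintype d] [DecidableEq d] in
/-- The derivative of a coordinate function on `ℝ^d` (private copy of
`Torus.fderiv_apply_coord` of `TorusEnstrophyOrthogonality`, not imported here). [folklore] -/
private theorem fderiv_apply_coord' [Fintype d] (i : d) (w v : EuclideanSpace ℝ d) :
    _root_.fderiv ℝ (fun w : EuclideanSpace ℝ d => w i) w v = v i := by
  have h : (fun w : EuclideanSpace ℝ d => w i) = (EuclideanSpace.proj (𝕜 := ℝ) i) := by
    funext w; simp
  rw [h, ContinuousLinearMap.fderiv]
  simp

/-- **Moment identity for the mollifier**: `∫_{T^d} ∂ⱼk_ε(z) (reprc z)ᵢ dz = -δᵢⱼ`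
(integration by parts on `ℝ^d` for the profile `ρ_ε`, which has unit mass). [folklore] -/
theorem integral_partialDeriv_kernel_mul_reprc (hε : 0 < ε) (hε' : ε ≤ 1 / 4) (i j : d) :
    ∫ z, partialDeriv j (kernel ε) z * reprc z i = if i = j then -1 else 0 := by
  set ρ : EuclideanSpace ℝ d → ℝ := profile (d := d) ε with hρ
  set ej : EuclideanSpace ℝ d := EuclideanSpace.single j 1 with hej
  have hρc : ContDiff ℝ ∞ ρ := contDiff_profile ε
  have hρcs : HasCompactSupport ρ := hasCompactSupport_profile hε
  have hρ1 : ContDiff ℝ 1 ρ := hρc.of_le (by simp)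
  -- rewrite as an integral over `ℝ^d`
  set G : EuclideanSpace ℝ d → ℝ := fun w => _root_.fderiv ℝ ρ w ej * w i with hG
  have h1 : ∫ z, partialDeriv j (kernel ε) z * reprc z i = ∫ z : UnitAddTorus d, G (reprc z) := by
    refine integral_congr_ae (Eventually.of_forall fun z => ?_)
    simp only [hG, hρ, hej, partialDeriv_kernel_eq hε hε']
  have hGsupp : support G ⊆ ball 0 (1 / 2) := by
    intro w hw
    rw [mem_support] at hw
    have hw' : _root_.fderiv ℝ ρ w ≠ 0 := fun h => hw (by simp [hG, h])
    have : ‖w‖ ≤ ε := by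
      by_contra h
      exact hw' (fderiv_profile_eq_zero hε (lt_of_not_ge h))
    rw [mem_ball_zero_iff]
    linarith
  rw [h1, integral_comp_reprc_of_support_subset hGsupp]
  -- integration by parts on `ℝ^d`
  have hcoord : ∀ w v : EuclideanSpace ℝ d, _root_.fderiv ℝ (fun w : EuclideanSpace ℝ d => w i) w v = v i :=
    fderiv_apply_coord' i
  have hfd : Continuous (_root_.fderiv ℝ ρ) := hρ1.continuous_fderiv one_ne_zero
  have hI1 : Integrable (fun w : EuclideanSpace ℝ d =>
      _root_.fderiv ℝ (fun w : EuclideanSpace ℝ d => w i) w ej * ρ w) := by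
    simp_rw [hcoord]
    exact (hρc.continuous.integrable_of_hasCompactSupport hρcs).const_mul _
  have hI2 : Integrable (fun w : EuclideanSpace ℝ d => w i * _root_.fderiv ℝ ρ w ej) := by
    refine Continuous.integrable_of_hasCompactSupport ?_ ?_
    · exact ((EuclideanSpace.proj (𝕜 := ℝ) i).continuous).mul (hfd.clm_apply continuous_const)
    · exact (hρcs.fderiv_apply (𝕜 := ℝ) ej).mul_left
  have hI3 : Integrable (fun w : EuclideanSpace ℝ d => w i * ρ w) :=
    (((EuclideanSpace.proj (𝕜 := ℝ) i).continuous).mul hρc.continuous).integrable_of_hasCompactSupport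
      hρcs.mul_left
  have hibp := integral_mul_fderiv_eq_neg_fderiv_mul_of_integrable (μ := volume) hI1 hI2 hI3
    (fun w _ => (EuclideanSpace.proj (𝕜 := ℝ) i).differentiableAt)
    (fun w _ => (hρ1.differentiable one_ne_zero w))
  have h2 : ∫ w, G w = ∫ w : EuclideanSpace ℝ d, w i * _root_.fderiv ℝ ρ w ej :=
    integral_congr_ae (Eventually.of_forall fun w => mul_comm _ _)
  rw [h2, hibp]
  simp_rw [hcoord]
  rw [integral_const_mul, hρ, integral_profile hε, mul_one, hej, PiLp.single_apply]
  split_ifs <;> simp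

/-! ## Convergence of mollified gradients at points of differentiability -/

omit [Fintype d] [DecidableEq d] in
/-- Expansion of a vector of `ℝ^d` in the standard basis. [folklore] -/
theorem eq_sum_smul_single [Fintype d] [DecidableEq d] (w : EuclideanSpace ℝ d) :
    w = ∑ i, w i • EuclideanSpace.single i (1 : ℝ) := by
  have h := (EuclideanSpace.basisFun d ℝ).toBasis.sum_repr w
  simp only [OrthonormalBasis.coe_toBasis_repr_apply, EuclideanSpace.basisFun_repr,
    OrthonormalBasis.coe_toBasis, EuclideanSpace.basisFun_apply] at h
  exact h.symm

omit [Fintype d] [DecidableEq d] in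
/-- `‖w‖ ≤ ∑ᵢ |wᵢ|` in `ℝ^d`. [folklore] -/
theorem norm_le_sum_abs [Fintype d] [DecidableEq d] (w : EuclideanSpace ℝ d) : ‖w‖ ≤ ∑ i, |w i| := by
  conv_lhs => rw [eq_sum_smul_single w]
  refine (norm_sum_le _ _).trans (le_of_eq (Finset.sum_congr rfl fun i _ => ?_))
  rw [norm_smul, PiLp.norm_single, norm_one, mul_one, Real.norm_eq_abs]

/-- **Pointwise convergence of mollified gradients of Lipschitz functions**: if the
`L`-Lipschitz `ζ` is differentiable (through its re-centred lift) at `x`, then for every `η > 0`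
there is `ε₀ > 0` with `‖∇(ζ ⋆ k_ε)(x) - ∇ζ(x)‖ ≤ η` for all `0 < ε ≤ ε₀` (`ε ≤ 1/4`)
(Evans 2010, §5.8.3 / App. C.4 Thm. 7, here in quantitative pointwise form: first-order Taylor
expansion on the support of `∂ⱼk_ε` and the moment identity). [folklore] -/
theorem norm_gradient_convolution_kernel_sub_le (hζ : LipschitzWith L ζ) {x : UnitAddTorus d}
    (hx : DifferentiableAt ℝ (liftAt ζ x) 0) {η : ℝ} (hη : 0 < η) :
    ∃ ε₀ > 0, ∀ ε, 0 < ε → ε ≤ ε₀ → ε ≤ 1 / 4 →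
      ‖Torus.gradient (ζ ⋆ kernel ε) x - Torus.gradient ζ x‖ ≤ η := by
  have hζc : Continuous ζ := hζ.continuous
  have hζi : Integrable ζ volume := hζc.integrable_unitAddTorus
  set D : EuclideanSpace ℝ d →L[ℝ] ℝ := _root_.fderiv ℝ (liftAt ζ x) 0 with hDdef
  have hD : HasFDerivAt (liftAt ζ x) D 0 := hx.hasFDerivAt
  set C₁ : ℝ := gradProfileMass d with hC₁
  have hC₁0 : 0 ≤ C₁ := gradProfileMass_nonneg
  set η' : ℝ := η / ((Fintype.card d + 1) * (C₁ + 1)) with hη'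
  have hη'0 : 0 < η' := by positivity
  -- first-order Taylor bound
  have hTaylor : ∀ᶠ w in 𝓝 (0 : EuclideanSpace ℝ d), ‖liftAt ζ x (0 + w) - liftAt ζ x 0 - D w‖ ≤ η' * ‖w‖ :=
    (hasFDerivAt_iff_isLittleO_nhds_zero.1 hD).def hη'0
  obtain ⟨ε₀, hε₀, hball⟩ := Metric.eventually_nhds_iff.1 hTaylor
  refine ⟨ε₀ / 2, half_pos hε₀, fun ε hε hεε₀ hε4 => ?_⟩
  have hk : IsSmooth (kernel (d := d) ε) := isSmooth_kernel hε hε4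
  have hk1 : IsContDiff 1 (kernel (d := d) ε) := hk.isContDiff (by simp)
  have hkjc : ∀ j, Continuous (partialDeriv j (kernel (d := d) ε)) := fun j => (hk.partialDeriv j).continuous
  -- the remainder `r z = ζ(x - z) - ζ(x) + D(reprc z)`
  set r : UnitAddTorus d → ℝ := fun z => ζ (x - z) - ζ x + D (reprc z) with hr
  have hr_bound : ∀ z : UnitAddTorus d, ‖reprc z‖ ≤ ε → |r z| ≤ η' * ε := by
    intro z hz
    have hw : dist (-reprc z) (0 : EuclideanSpace ℝ d) < ε₀ := by
      rw [dist_zero_right, norm_neg]; linarith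
    have h := hball hw
    have e1 : liftAt ζ x (0 + -reprc z) = ζ (x - z) := by
      rw [zero_add, liftAt_apply, proj_neg, proj_reprc, ← sub_eq_add_neg]
    have e2 : liftAt ζ x 0 = ζ x := liftAt_apply_zero ζ x
    rw [e1, e2, map_neg, sub_neg_eq_add, Real.norm_eq_abs, norm_neg] at h
    exact h.trans (mul_le_mul_of_nonneg_left hz hη'0.le)
  -- `∫ |∂ⱼ k_ε| ≤ C₁ / ε`
  have hL1 : ∀ j, ∫ z, |partialDeriv j (kernel (d := d) ε) z| ≤ ε⁻¹ * C₁ := by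
    intro j
    have h := lintegral_enorm_partialDeriv_kernel_le (d := d) hε hε4 j
    have e : ∫ z, |partialDeriv j (kernel (d := d) ε) z| =
        (∫⁻ z, ‖partialDeriv j (kernel (d := d) ε) z‖ₑ).toReal := by
      rw [← integral_norm_eq_lintegral_enorm (hkjc j).aestronglyMeasurable]
      rfl
    rw [e]
    exact ENNReal.toReal_le_of_le_ofReal (by positivity) h
  -- componentwise error
  have hcomp : ∀ j, |partialDeriv j (ζ ⋆ kernel ε) x - D (EuclideanSpace.single j 1)| ≤ η' * C₁ := by
    intro j
    have hkj := hkjc j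
    have hkji : Integrable (partialDeriv j (kernel (d := d) ε)) volume := hkj.integrable_unitAddTorus
    -- the difference formula
    have hform : partialDeriv j (ζ ⋆ kernel ε) x =
        ∫ z, partialDeriv j (kernel ε) z * (ζ (x - z) - ζ x) := by
      rw [partialDeriv_convolution_kernel_apply hζi hε hε4 j x]
      rfl
    -- split the integrand
    have hsplit : ∀ z, partialDeriv j (kernel ε) z * (ζ (x - z) - ζ x) =
        partialDeriv j (kernel ε) z * r z -
          ∑ i, (partialDeriv j (kernel ε) z * reprc z i) * D (EuclideanSpace.single i 1) := by
      intro z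
      have hDsum : D (reprc z) = ∑ i, reprc z i * D (EuclideanSpace.single i 1) := by
        conv_lhs => rw [eq_sum_smul_single (reprc z)]
        rw [map_sum]
        refine Finset.sum_congr rfl fun i _ => ?_
        rw [map_smul, smul_eq_mul]
      have e : ∑ i, partialDeriv j (kernel ε) z * reprc z i * D (EuclideanSpace.single i 1) =
          partialDeriv j (kernel ε) z * D (reprc z) := by
        rw [hDsum, Finset.mul_sum]
        exact Finset.sum_congr rfl fun i _ => by ring
      rw [e, hr]
      ring
    -- the product with the remainder is dominated by `|∂ⱼk_ε| η' ε`
    have hprod : ∀ z, |partialDeriv j (kernel ε) z * r z| ≤ |partialDeriv j (kernel ε) z| * (η' * ε) := by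
      intro z
      by_cases hz : partialDeriv j (kernel ε) z = 0
      · simp [hz]
      · rw [abs_mul]
        exact mul_le_mul_of_nonneg_left
          (hr_bound z (norm_reprc_le_of_partialDeriv_kernel_ne_zero hε hε4 hz)) (abs_nonneg _)
    have hrm : AEStronglyMeasurable r volume := by
      refine (((hζc.comp (continuous_const.sub continuous_id)).sub continuous_const).aestronglyMeasurable).add ?_
      exact (D.continuous.measurable.comp measurable_reprc).aestronglyMeasurable
    have hIr : Integrable (fun z => partialDeriv j (kernel ε) z * r z) volume := by
      refine Integrable.mono' ((hkji.norm).mul_const (η' * ε)) (hkj.aestronglyMeasurable.mul hrm)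
        (Eventually.of_forall fun z => ?_)
      rw [Real.norm_eq_abs, Real.norm_eq_abs]
      exact hprod z
    have hIi : ∀ i, Integrable (fun z => (partialDeriv j (kernel ε) z * reprc z i) *
        D (EuclideanSpace.single i 1)) volume := by
      intro i
      have hmi : Measurable fun z : UnitAddTorus d => reprc z i :=
        (EuclideanSpace.proj (𝕜 := ℝ) i).continuous.measurable.comp measurable_reprc
      refine (hkji.mul_bdd (c := 1 / 2) hmi.aestronglyMeasurable
        (Eventually.of_forall fun z => ?_)).mul_const _
      rw [Real.norm_eq_abs]
      exact abs_reprc_apply_le z i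
    -- integrate the split
    have hint_split : partialDeriv j (ζ ⋆ kernel ε) x =
        (∫ z, partialDeriv j (kernel ε) z * r z) + D (EuclideanSpace.single j 1) := by
      rw [hform, integral_congr_ae (Eventually.of_forall hsplit), integral_sub hIr
        (integrable_finsetSum _ fun i _ => hIi i), integral_finsetSum _ fun i _ => hIi i]
      have hmom : ∀ i, ∫ z, partialDeriv j (kernel ε) z * reprc z i * D (EuclideanSpace.single i 1) =
          (if i = j then -1 else 0) * D (EuclideanSpace.single i 1) := fun i => by
        rw [integral_mul_const, integral_partialDeriv_kernel_mul_reprc hε hε4 i j]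
      simp_rw [hmom]
      rw [Finset.sum_eq_single j (fun i _ hij => by simp [hij]) (fun h => (h (Finset.mem_univ j)).elim)]
      simp
    rw [hint_split, add_sub_cancel_right]
    calc |∫ z, partialDeriv j (kernel ε) z * r z|
        ≤ ∫ z, |partialDeriv j (kernel ε) z| * (η' * ε) := by
          rw [← Real.norm_eq_abs]
          exact norm_integral_le_of_norm_le ((hkji.norm).mul_const _)
            (Eventually.of_forall fun z => by rw [Real.norm_eq_abs]; exact hprod z)
      _ = (∫ z, |partialDeriv j (kernel ε) z|) * (η' * ε) := integral_mul_const _ _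
      _ ≤ (ε⁻¹ * C₁) * (η' * ε) := mul_le_mul_of_nonneg_right (hL1 j) (by positivity)
      _ = η' * C₁ := by field_simp
  -- from components to the norm
  have hconv1 : IsContDiff 1 (ζ ⋆ kernel (d := d) ε) := (isSmooth_convolution hζi hk).isContDiff (by simp)
  have hcoord : ∀ j, (Torus.gradient (ζ ⋆ kernel ε) x - Torus.gradient ζ x) j =
      partialDeriv j (ζ ⋆ kernel ε) x - D (EuclideanSpace.single j 1) := by
    intro j
    have h1 : Torus.gradient (ζ ⋆ kernel ε) x j = partialDeriv j (ζ ⋆ kernel ε) x :=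
      gradient_apply hconv1 x j
    have h2 : Torus.gradient ζ x j = D (EuclideanSpace.single j 1) := by
      have h := inner_gradient_left ζ x (EuclideanSpace.single j 1)
      rw [EuclideanSpace.inner_single_right, one_mul] at h
      simpa [hDdef, Torus.fderiv] using h
    rw [PiLp.sub_apply, h1, h2]
  calc ‖Torus.gradient (ζ ⋆ kernel ε) x - Torus.gradient ζ x‖
      ≤ ∑ j, |(Torus.gradient (ζ ⋆ kernel ε) x - Torus.gradient ζ x) j| := norm_le_sum_abs _
    _ ≤ ∑ _j : d, η' * C₁ := Finset.sum_le_sum fun j _ => by rw [hcoord]; exact hcomp j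
    _ = Fintype.card d * (η' * C₁) := by rw [Finset.sum_const, Finset.card_univ, nsmul_eq_mul]
    _ ≤ η := by
        rw [hη']
        have h1 : (Fintype.card d : ℝ) * C₁ ≤ (Fintype.card d + 1) * (C₁ + 1) := by nlinarith
        have h2 : 0 < ((Fintype.card d : ℝ) + 1) * (C₁ + 1) := by positivity
        calc (Fintype.card d : ℝ) * (η / ((Fintype.card d + 1) * (C₁ + 1)) * C₁)
            = η * ((Fintype.card d * C₁) / ((Fintype.card d + 1) * (C₁ + 1))) := by ring
          _ ≤ η * 1 := by
              refine mul_le_mul_of_nonneg_left ?_ hη.le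
              rw [div_le_one h2]
              exact h1
          _ = η := mul_one η

end Torus

end Literature.Analysis.FunctionSpaces
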